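import Summits.AtomisticToContinuum.Crystallization.Theorems.ThreeConeCertificateOnePercentCertificateFccWindow
import HarnessLib

/-!
# `OnePercentCertificate` fcc window `0.7175` — the lattice box sum certified IN THE KERNEL (standard axioms, no `native_decide`)

`…OnePercentCertificateFccWindow.sumBoxQ_le` (hand-1 g13 / lead c3) certifies the `456 336`-term Lennard-Jones box sum of `(a/√2)·D₃`, `a² = 943/1000`,
over the even vectors of `[−48, 48]³` by `native_decide` on an exact rational with `≈ 7 000`-digit numerator and denominator; everything downstream
(`eStar_le : e⋆ ≤ −0.7175`, `…PeriodicEnergyCeiling.periodicEnergyCeiling_holds` = the binder `UP(−0.7175)` of the 27623 junctions, the whole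
`…Free` / `…CoreFree` computational lane of the crux `AperiodicFrustratedLawGap`) inherits the axiom `Lean.ofReduceBool`.

This module re-certifies the SAME inequality `sumBoxQ ≤ −1.4350` by KERNEL reduction (`decide +kernel`, axioms ⊆ {propext, Classical.choice, Quot.sound}):

* §1 the integer certificate: per squared index norm `m = a² + b² + c²` the term `φ(m) = (1/12)(943m/2000)⁻⁶ − (1/6)(943m/2000)⁻³` is bounded ABOVE in
  fixed point `2⁻⁴⁴` by `U = (⌊A/B(m)⌋ + 1) − ⌊C/D(m)⌋` (`A = 2⁴⁴·2000⁶`, `B(m) = 12·943⁶·m⁶`, `C = 2⁴⁴·2000³`, `D(m) = 6·943³·m³`; two roundings, `< 2` ulp per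
  term, `9·10⁵` ulp `≈ 5·10⁻⁸` in total against the margin `1.46·10⁻⁵`); the box sum is folded over the SIGN-ORBIT representatives `(a, b, c) ∈ [0, 48]³`
  (`a = |i − 48|`) with weights `wt a · wt b · wt c`, `wt 0 = 1`, `wt d = 2` (`117 649` instead of `912 673` triples) by structural recursion (`rsumZ`);
  ★ `foldU_le : foldU + ⌈1.435·2⁴⁴⌉ ≤ 0` — ONE kernel fact (`decide +kernel`, default options, ≈ 35 s on the farm);
* §2 the bridge to the tree's rational sum: `rsumZ = Finset.sum`, the fibre count `#{i < 97 : |i − 48| = d} = wt d`, hence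
  `∑_{i<97} h |i−48| = ∑_{d<49} wt d • h d` (`sum_comp_dW`), the box summand as a function of `(|i−48|, |j−48|, |k−48|)` (`summand_eq`), the term bound
  `G ≤ U / 2⁴⁴` (`G_le_U`: `Nat.lt_div_mul_add` / `Nat.cast_div_le`), ★★ `sumBoxQ_le_foldU : sumBoxQ ≤ foldU / 2⁴⁴` and ★★ `foldU_div_le : foldU / 2⁴⁴ ≤ −1.4350`;
* §3 ★★★ `sumBoxQ_le_kernel : sumBoxQ ≤ −(14350/10000)` — the statement of `…FccWindow.sumBoxQ_le`, now with standard axioms (kept under a distinct name;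
  the downstream standard-axiom forms of `eStar_le` / `UP(−0.7175)` / the `…Free` junctions are drawn in `…AperiodicGapRecordJunctionVerdictFree`).

decomp-a2c hand-2 g35 (structural share on stmt-AtomisticToContinuum-27623: binder `UP(−0.7175)` of `…RecordJunctionCore` §3 discharged with standard axioms).
Kernel definitions + bookkeeping lemmas; 0 sorry; no `native_decide`; no instances / notation / `#eval`.  [folklore; certified computation]
-/

namespace Summit.AtomisticToContinuum.Crystallization.Theorems.OnePercentFccWindowKernel

open scoped BigOperators
open Finset (range)
open Summit.AtomisticToContinuum.Crystallization.Theorems.OnePercentFccWindow (nW crd boxW sqN phiQ sumBoxQ)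

/-! ## §1 The integer certificate (kernel reduction) -/

/-- `|i − 48|` on `ℕ` (truncated subtractions; one of the two summands vanishes). [folklore] -/
def dW (i : ℕ) : ℕ := (i - 48) + (48 - i)

/-- The sign-orbit weight of a coordinate magnitude: `1` for `0`, `2` otherwise. [folklore] -/
def wt (d : ℕ) : ℕ := if d = 0 then 1 else 2

/-- The fixed-point scale `2⁴⁴`. [folklore] -/
def SW : ℕ := 2 ^ 44

/-- Scaled numerator of the repulsive term, `2⁴⁴ · 2000⁶`. [folklore] -/
def AW : ℕ := SW * 2000 ^ 6

/-- Scaled numerator of the attractive term, `2⁴⁴ · 2000³`. [folklore] -/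
def CW : ℕ := SW * 2000 ^ 3

/-- Denominator of the repulsive term at squared index norm `m`: `12 · 943⁶ · m⁶`. [folklore] -/
def BW (m : ℕ) : ℕ := 12 * 943 ^ 6 * m ^ 6

/-- Denominator of the attractive term at squared index norm `m`: `6 · 943³ · m³`. [folklore] -/
def DW (m : ℕ) : ℕ := 6 * 943 ^ 3 * m ^ 3

/-- ★ The fixed-point UPPER value of the term at `(a, b, c)`: `(⌊A/B(m)⌋ + 1) − ⌊C/D(m)⌋`, `m = a² + b² + c²`; `0` off the filter. [folklore] -/
def U (a b c : ℕ) : ℤ :=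
  if (a + b + c) % 2 = 0 ∧ a ^ 2 + b ^ 2 + c ^ 2 ≠ 0 then
    ((AW / BW (a ^ 2 + b ^ 2 + c ^ 2) + 1 : ℕ) : ℤ) - ((CW / DW (a ^ 2 + b ^ 2 + c ^ 2) : ℕ) : ℤ)
  else 0

/-- `Σ_{k<n} g k` over `ℤ` by structural recursion (kernel-reducible). [folklore] -/
def rsumZ (g : ℕ → ℤ) : ℕ → ℤ
  | 0 => 0
  | n + 1 => rsumZ g n + g n

/-- ★ The weighted triple fold of `U` over the orbit representatives `[0, 48]³`. [folklore] -/
def foldU : ℤ :=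
  rsumZ (fun a => (wt a : ℤ) * rsumZ (fun b => (wt b : ℤ) * rsumZ (fun c => (wt c : ℤ) * U a b c) 49) 49) 49

/-- `⌈1.435 · 2⁴⁴⌉ = 25 244 786 973 737`. [folklore] -/
def bndZ : ℤ := 25244786973737

/-- ★ **THE KERNEL FACT**: the weighted fixed-point upper sum is `≤ −⌈1.435·2⁴⁴⌉` (`117 649` triples, two integer divisions each; `decide +kernel`).
[certified computation, standard axioms] -/
theorem foldU_le : foldU + bndZ ≤ 0 := by
  decide +kernel

/-! ## §2 The bridge to the tree's rational box sum -/

/-- `rsumZ g n = ∑_{k<n} g k`. [formal bookkeeping] -/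
theorem rsumZ_eq_sum (g : ℕ → ℤ) (n : ℕ) : rsumZ g n = ∑ k ∈ range n, g k := by
  induction n with
  | zero => simp [rsumZ]
  | succ n ih => rw [rsumZ, ih, Finset.sum_range_succ]

/-- The fibre of `|· − 48|` over `d < 49` inside `{0,…,96}` has `wt d` elements (`{48}` resp. `{48 − d, 48 + d}`). [folklore] -/
theorem card_fiber_dW {d : ℕ} (hd : d < 49) : ((range 97).filter fun i => dW i = d).card = wt d := by
  by_cases h0 : d = 0
  · subst h0
    have h : ((range 97).filter fun i => dW i = 0) = {48} := by
      ext i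
      simp only [Finset.mem_filter, Finset.mem_range, Finset.mem_singleton, dW]
      omega
    rw [h, Finset.card_singleton, wt, if_pos rfl]
  · have h : ((range 97).filter fun i => dW i = d) = {48 - d, 48 + d} := by
      ext i
      simp only [Finset.mem_filter, Finset.mem_range, Finset.mem_insert, Finset.mem_singleton, dW]
      omega
    rw [h, Finset.card_pair (by omega), wt, if_neg h0]

/-- ★ **SIGN-ORBIT FOLDING in one coordinate**: `∑_{i<97} h |i − 48| = ∑_{d<49} wt d • h d`. [folklore] -/
theorem sum_comp_dW {M : Type*} [AddCommMonoid M] (h : ℕ → M) :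
    ∑ i ∈ range 97, h (dW i) = ∑ d ∈ range 49, wt d • h d := by
  rw [← Finset.sum_fiberwise_of_maps_to (s := range 97) (t := range 49) (g := dW)
    (fun i hi => Finset.mem_range.2 (by have := Finset.mem_range.1 hi; unfold dW; omega))]
  refine Finset.sum_congr rfl fun d hd => ?_
  rw [Finset.sum_congr rfl fun i hi => (by rw [(Finset.mem_filter.1 hi).2] : h (dW i) = h d), Finset.sum_const,
    card_fiber_dW (Finset.mem_range.1 hd)]

/-- The rational summand on orbit representatives: `φ(a² + b² + c²)` on the filter, `0` off it. [folklore] -/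
def G (a b c : ℕ) : ℚ :=
  if (a + b + c) % 2 = 0 ∧ a ^ 2 + b ^ 2 + c ^ 2 ≠ 0 then phiQ ((a ^ 2 + b ^ 2 + c ^ 2 : ℕ) : ℤ) else 0

/-- `crd i² = |i − 48|²` in `ℤ`. [formal bookkeeping] -/
theorem crd_sq (i : ℕ) : crd i ^ 2 = ((dW i : ℕ) : ℤ) ^ 2 := by
  unfold crd dW
  rcases Nat.lt_or_ge i 48 with h | h
  · have e : (((i - 48) + (48 - i) : ℕ) : ℤ) = 48 - (i : ℤ) := by omega
    rw [e]; ring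
  · have e : (((i - 48) + (48 - i) : ℕ) : ℤ) = (i : ℤ) - 48 := by omega
    rw [e]

/-- `sqN (i, j, k) = |i−48|² + |j−48|² + |k−48|²`. [formal bookkeeping] -/
theorem sqN_eq (i j k : ℕ) : sqN (i, j, k) = ((dW i ^ 2 + dW j ^ 2 + dW k ^ 2 : ℕ) : ℤ) := by
  unfold sqN
  push_cast
  rw [crd_sq, crd_sq, crd_sq]

/-- `|i − 48| = 0 ↔ i = 48`. [formal bookkeeping] -/
theorem dW_eq_zero {i : ℕ} : dW i = 0 ↔ i = 48 := by unfold dW; omega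

/-- A sum of three squares in `ℕ` vanishes iff all three do. [formal bookkeeping] -/
theorem sq3_eq_zero {x y z : ℕ} : x ^ 2 + y ^ 2 + z ^ 2 = 0 ↔ x = 0 ∧ y = 0 ∧ z = 0 := by
  refine ⟨fun h => ?_, fun ⟨hx, hy, hz⟩ => by simp [hx, hy, hz]⟩
  have hx : x ^ 2 = 0 := by omega
  have hy : y ^ 2 = 0 := by omega
  have hz : z ^ 2 = 0 := by omega
  exact ⟨pow_eq_zero_iff (two_ne_zero) |>.1 hx, pow_eq_zero_iff (two_ne_zero) |>.1 hy, pow_eq_zero_iff (two_ne_zero) |>.1 hz⟩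

/-- The box filter read on orbit representatives. [formal bookkeeping] -/
theorem cond_iff (i j k : ℕ) :
    ((i, j, k) ≠ ((48 : ℕ), (48 : ℕ), (48 : ℕ)) ∧ (i + j + k) % 2 = 0) ↔
      ((dW i + dW j + dW k) % 2 = 0 ∧ dW i ^ 2 + dW j ^ 2 + dW k ^ 2 ≠ 0) := by
  have hpar : (i + j + k) % 2 = 0 ↔ (dW i + dW j + dW k) % 2 = 0 := by unfold dW; omega
  have horg : (i, j, k) ≠ ((48 : ℕ), (48 : ℕ), (48 : ℕ)) ↔ dW i ^ 2 + dW j ^ 2 + dW k ^ 2 ≠ 0 := by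
    rw [Ne, Ne, sq3_eq_zero, dW_eq_zero, dW_eq_zero, dW_eq_zero]
    simp only [Prod.mk.injEq]
  rw [hpar, horg, and_comm]

/-- ★ The box summand depends only on `(|i−48|, |j−48|, |k−48|)`: it is `G (dW i) (dW j) (dW k)`. [folklore] -/
theorem summand_eq (i j k : ℕ) {hd : Decidable (((i, j, k) ≠ ((48 : ℕ), (48 : ℕ), (48 : ℕ)) ∧ (i + j + k) % 2 = 0))} :
    @ite ℚ (((i, j, k) ≠ ((48 : ℕ), (48 : ℕ), (48 : ℕ)) ∧ (i + j + k) % 2 = 0)) hd (phiQ (sqN (i, j, k))) 0 =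
      G (dW i) (dW j) (dW k) := by
  unfold G
  exact if_congr (cond_iff i j k) (by rw [sqN_eq]) rfl

/-- ★ The tree's box sum as the WEIGHTED iterated sum over orbit representatives. [folklore] -/
theorem sumBoxQ_eq_weighted :
    sumBoxQ = ∑ a ∈ range 49, wt a • ∑ b ∈ range 49, wt b • ∑ c ∈ range 49, wt c • G a b c := by
  have h97 : nW = 97 := rfl
  have h0 : sumBoxQ = ∑ i ∈ range 97, ∑ j ∈ range 97, ∑ k ∈ range 97, G (dW i) (dW j) (dW k) := by
    rw [sumBoxQ, boxW, Finset.sum_filter, h97, Finset.sum_product]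
    refine Finset.sum_congr rfl fun i _ => ?_
    rw [Finset.sum_product]
    refine Finset.sum_congr rfl fun j _ => Finset.sum_congr rfl fun k _ => ?_
    exact summand_eq i j k
  have h3 : ∀ a b : ℕ, ∑ k ∈ range 97, G a b (dW k) = ∑ c ∈ range 49, wt c • G a b c := fun a b => sum_comp_dW (G a b)
  have h2 : ∀ a : ℕ, ∑ j ∈ range 97, ∑ k ∈ range 97, G a (dW j) (dW k) = ∑ b ∈ range 49, wt b • ∑ c ∈ range 49, wt c • G a b c := by
    intro a
    rw [Finset.sum_congr rfl fun j _ => h3 a (dW j)]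
    exact sum_comp_dW (fun b => ∑ c ∈ range 49, wt c • G a b c)
  rw [h0, Finset.sum_congr rfl fun i _ => h2 (dW i)]
  exact sum_comp_dW (fun a => ∑ b ∈ range 49, wt b • ∑ c ∈ range 49, wt c • G a b c)

/-- The two Lennard-Jones terms at squared index norm `m ≠ 0` in the certificate's integers: `φ(m) = A/(2⁴⁴·B(m)) − C/(2⁴⁴·D(m))`. [folklore] -/
theorem phiQ_eq {m : ℕ} (hm : m ≠ 0) :
    phiQ (m : ℤ) = (AW : ℚ) / ((SW : ℚ) * (BW m : ℚ)) - (CW : ℚ) / ((SW : ℚ) * (DW m : ℚ)) := by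
  have hm' : (m : ℚ) ≠ 0 := by exact_mod_cast hm
  unfold phiQ AW CW BW DW SW
  push_cast
  field_simp
  ring

/-- ★ THE TERM BOUND: `G a b c ≤ U a b c / 2⁴⁴` (ceiling by `⌊·⌋ + 1` on the repulsive term, floor on the attractive term). [folklore] -/
theorem G_le_U (a b c : ℕ) : G a b c ≤ ((U a b c : ℤ) : ℚ) / (SW : ℚ) := by
  unfold G U
  by_cases hc : (a + b + c) % 2 = 0 ∧ a ^ 2 + b ^ 2 + c ^ 2 ≠ 0
  · rw [if_pos hc, if_pos hc]
    generalize hm : a ^ 2 + b ^ 2 + c ^ 2 = m at hc ⊢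
    have hm0 : m ≠ 0 := hc.2
    have hS : (0 : ℚ) < SW := by unfold SW; positivity
    have hB : 0 < BW m := by unfold BW; positivity
    have hBq : (0 : ℚ) < BW m := by exact_mod_cast hB
    have hBne : (BW m : ℚ) ≠ 0 := hBq.ne'
    have hD : 0 < DW m := by unfold DW; positivity
    have hDne : (DW m : ℚ) ≠ 0 := by exact_mod_cast hD.ne'
    have hSne : (SW : ℚ) ≠ 0 := hS.ne'
    -- the two roundings
    have h1 : (AW : ℚ) / BW m ≤ ((AW / BW m + 1 : ℕ) : ℚ) := by
      rw [div_le_iff₀ hBq]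
      have h := (Nat.lt_div_mul_add (a := AW) hB).le
      calc (AW : ℚ) ≤ ((AW / BW m * BW m + BW m : ℕ) : ℚ) := by exact_mod_cast h
        _ = ((AW / BW m + 1 : ℕ) : ℚ) * (BW m : ℚ) := by push_cast; ring
    have h2 : ((CW / DW m : ℕ) : ℚ) ≤ (CW : ℚ) / DW m := Nat.cast_div_le
    rw [phiQ_eq hm0]
    have e : (AW : ℚ) / ((SW : ℚ) * BW m) - (CW : ℚ) / ((SW : ℚ) * DW m) = ((AW : ℚ) / BW m - (CW : ℚ) / DW m) / SW := by
      field_simp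
    rw [e]
    refine div_le_div_of_nonneg_right ?_ hS.le
    simp only [Int.cast_sub, Int.cast_natCast]
    linarith
  · rw [if_neg hc, if_neg hc]
    simp

/-- `foldU` as the weighted iterated rational sum of `U`. [formal bookkeeping] -/
theorem foldU_cast :
    ((foldU : ℤ) : ℚ) = ∑ a ∈ range 49, (wt a : ℚ) * ∑ b ∈ range 49, (wt b : ℚ) * ∑ c ∈ range 49, (wt c : ℚ) * ((U a b c : ℤ) : ℚ) := by
  simp only [foldU, rsumZ_eq_sum]
  push_cast
  rfl

/-- ★★ `sumBoxQ ≤ foldU / 2⁴⁴` (the term bound summed with the non-negative weights). [folklore] -/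
theorem sumBoxQ_le_foldU : sumBoxQ ≤ ((foldU : ℤ) : ℚ) / (SW : ℚ) := by
  rw [sumBoxQ_eq_weighted, foldU_cast, Finset.sum_div]
  refine Finset.sum_le_sum fun a _ => ?_
  rw [nsmul_eq_mul, mul_div_assoc, Finset.sum_div]
  refine mul_le_mul_of_nonneg_left (Finset.sum_le_sum fun b _ => ?_) (by positivity)
  rw [nsmul_eq_mul, mul_div_assoc, Finset.sum_div]
  refine mul_le_mul_of_nonneg_left (Finset.sum_le_sum fun c _ => ?_) (by positivity)
  rw [nsmul_eq_mul, mul_div_assoc]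
  exact mul_le_mul_of_nonneg_left (G_le_U a b c) (by positivity)

/-- ★★ `foldU / 2⁴⁴ ≤ −1.4350` (the kernel fact and `1.435·2⁴⁴ ≤ ⌈1.435·2⁴⁴⌉`). [folklore] -/
theorem foldU_div_le : ((foldU : ℤ) : ℚ) / (SW : ℚ) ≤ -(14350 / 10000) := by
  have hS : (0 : ℚ) < SW := by unfold SW; positivity
  have hk : ((foldU : ℤ) : ℚ) ≤ -((bndZ : ℤ) : ℚ) := by exact_mod_cast (by linarith [foldU_le] : foldU ≤ -bndZ)
  have hb : (14350 / 10000 : ℚ) * SW ≤ ((bndZ : ℤ) : ℚ) := by unfold bndZ SW; norm_num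
  rw [div_le_iff₀ hS]
  linarith

/-! ## §3 The certificate with standard axioms -/

/-- ★★★ **`sumBoxQ ≤ −1.4350` WITH STANDARD AXIOMS** — the statement of `…OnePercentCertificateFccWindow.sumBoxQ_le` (there by `native_decide`), here by
kernel reduction of the fixed-point certificate. [certified computation] -/
theorem sumBoxQ_le_kernel : sumBoxQ ≤ -(14350 / 10000) :=
  sumBoxQ_le_foldU.trans foldU_div_le

end Summit.AtomisticToContinuum.Crystallization.Theorems.OnePercentFccWindowKernel
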